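import Summits.NavierStokesRegularity.NavierStokesRegularity.Theorems.StrainDoorsQuadrupole
import Summits.NavierStokesRegularity.NavierStokesRegularity.Theorems.StrainDoorsLocalNewtonB3
import HarnessLib

/-!
# StrainDoorsQuadrupoleClosers — door D9 «QuadrupoleFlatnessDoor» (ROUND-47, nsreg-p1 g34) CLOSED BY NAME

`quadrupoleFlatnessDoor_holds : QuadrupoleFlatnessDoor` := p1's `quadrupoleFlatnessDoor_of_B3` (`StrainDoorsQuadrupole`,
LEAD landing of r47 4beaceea99ea83e4) applied to ns-s29-p2 g5's atom B3 `hessSmoothingEnergyBound_holds`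
(`StrainDoorsLocalNewtonB3`, p681897).  `--supports stmt-NavierStokesRegularity-0056 --as helper`.
HONEST FRAME: D9 is a CONDITIONAL continuation criterion (hypothesis = quadrupole-flat near-field parity at charged almost
strain maximisers); closing it BY NAME proves the implication, not regularity; 0056 `NoTypeII` / 10661 / NS regularity NOT proved.
-/

set_option linter.dupNamespace false

namespace Summit.NavierStokesRegularity.NavierStokesRegularity.Theorems.StrainDoors

/-- ★★ **door D9 «QuadrupoleFlatnessDoor» CLOSED BY NAME** (over atom B3). -/
theorem quadrupoleFlatnessDoor_holds : QuadrupoleFlatnessDoor :=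
  quadrupoleFlatnessDoor_of_B3 hessSmoothingEnergyBound_holds

/-- D9 follows from the closed D8′ as well (bookkeeping twin). -/
example : QuadrupoleFlatnessDoor := quadrupoleFlatnessDoor_of_D8' fineStructureParityDoor_holds

end Summit.NavierStokesRegularity.NavierStokesRegularity.Theorems.StrainDoors
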